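import Summits.QuantumFields.YangMills.Theorems.BalabanUVNodesN15KingModelBlockFieldMeasureContinuumLimit

/-!
# BalabanUVNodes ∕ N15 — THE KING-MODEL RUNG (PART Ϡ-m): THE BLOCK-FIELD LAWS CONVERGE IN TOTAL VARIATION — `∫|ρ_K − ρ_∞| dψ → 0` (Scheffé by dominated convergence,
# uniform Gaussian majorant), HENCE `⟨F⟩_K → ⟨F⟩_∞` FOR EVERY BOUNDED MEASURABLE OBSERVABLE `F` OF THE UNIT-LATTICE FIELD
# (Track A, DAG node N15 = NE2; FAN-OUT v1.1 §N15 s3 «KING-MODEL RUNG … NE2's analogue DECIDED in the model»)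

HONEST FRAMING.  Count-neutral (cell `pub-ymgap`, seat `pub-ymgap-dag-n15-e` g32; `--supports stmt-QuantumFields-27366 --as helper` = K3⁸
`SpineGivenEndpointR13SepCoPHV`).  TEMPLATE LITERATURE: C. King, *The U(1) Higgs model. I. The continuum limit*, Commun. Math. Phys. **102** (1986) 649–677
[King1986] — KING's OWN `A = 0` FREE MODEL: the unit-lattice Gaussian densities `ρ_K = e^{−½⟨ψ,Δ^{(K)}ψ⟩}∕𝒩(Δ^{(K)})` of the `K`-fold block fields ((2.4)–(2.6) p. 652,
(2.14) p. 653; parts Τ-a∕Ϡ-k), Thm 2.1 (i) p. 654 and Thm 3.4 p. 656 («two models on the same unit lattice»); the limit `ρ_∞` of part Ϡ-k (precision `Δ^{(∞)}` in closed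
form).  NOT the interacting model; NOT Bałaban's objects; NOT a node discharge (N15 is booked through n15-a's knit, untouched here); nothing continuum-Yang–Mills ∕ ℝ⁴
∕ OS ∕ mass-gap ∕ Clay.  0 `sorry`; standard axioms; 0 `def`.

THE MATHEMATICS.  Along King's run `Δ^{(K)} ≤ a` as forms (the symbol (4.5) is `≤ a_K ≤ a`) and `Δ^{(K)} ≥ δ_∞` (part Ϡ-k), so `𝒩(Δ^{(K)}) ≥ (√(2π∕a))^{|Ω|}` (part Τ-a's
sandwich) and `ρ_K(ψ) ≤ e^{−½δ_∞|ψ|²}∕(√(2π∕a))^{|Ω|}` UNIFORMLY in `K ≥ 1` — an integrable majorant; with part Ϡ-k's pointwise convergence `ρ_K → ρ_∞`, dominated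
convergence gives `∫|ρ_K − ρ_∞|dψ → 0` (Scheffé's conclusion): the laws of the block fields converge in TOTAL VARIATION to the Gaussian with King's continuum action, and
the expectation of every bounded measurable functional of the unit-lattice field converges (`|⟨F⟩_K − ⟨F⟩_∞| ≤ sup|F|·∫|ρ_K − ρ_∞|`).

WHAT THIS FILE PROVES (kernel).  §1 `effSym_le_a'`, ★ `effLaplacian_form_le_a` (`⟨ψ,Δ^{(K)}ψ⟩ ≤ a|ψ|²`), ★ `gaussNorm_effLaplacian_ge` (`𝒩(Δ^{(K)}) ≥ (√(2π∕a))^{|Ω|}`),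
★ `gaussDensity_effLaplacian_le` (the uniform Gaussian majorant), `integrable_gaussDensity_lim`.  §2 ★★★ **`tendsto_integral_abs_gaussDensity_sub`** (`∫|ρ_K − ρ_∞| → 0`).
§3 ★★★ **`tendsto_integral_observable`** (`∫F ρ_K → ∫F ρ_∞` for every a.e.-strongly-measurable `F` with `|F| ≤ C`).

HONEST SCOPE.  The FREE model on a finite unit torus, odd `L ≥ 2`, `a, m² > 0`; Lebesgue reference measure on `ℝ^Ω`.  N15 untouched; counts unmoved.
Locators: [King1986] (2.4)–(2.6) p.652, (2.13)–(2.16) p.653, Thm 2.1 (2.22) p.654, Thm 3.4 (3.9) p.656, (3.89)–(3.93) pp.668–669, (4.5) p.670.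
-/

noncomputable section

open scoped BigOperators
open Finset Matrix Filter Topology MeasureTheory

namespace Summit.QuantumFields.YangMills.BalabanUVNodes.N15KingModelRung

open Literature.MathematicalPhysics.QuantumFieldTheory.Balaban1983to89.B5Prop11Plancherel (Tor)
open Literature.MathematicalPhysics.QuantumFieldTheory.Balaban1983to89.QGQInverse (Coercive)
open Literature.MathematicalPhysics.QuantumFieldTheory.King1986 (aK aK_pos aK_le)
open Literature.MathematicalPhysics.QuantumFieldTheory.King1986.Torus
open Summit.QuantumFields.YangMills.BalabanUVNodes.N15KingModelRung.FreeField (gaussNorm gaussNorm_pos integrable_gauss integral_gaussDensity coercive_scalar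
  quad_scalar gaussNorm_sandwich)

variable {d : ℕ}

section TV

variable (L : ℕ) (M : Fin (d + 1) → ℕ) [hM : ∀ μ, NeZero (M μ)]

/-! ## §1 The uniform Gaussian majorant of the densities -/

omit hM in
/-- `effSym ≤ a` (`a∕(1 + aS) ≤ a` for `a, S ≥ 0`). [cite: King1986, (4.5) p.670] -/
theorem effSym_le_a' (N : ℕ) [NeZero N] (Mv : Fin (d + 1) → ℕ) [∀ μ, NeZero (Mv μ)] {a c m2 : ℝ} (ha : 0 ≤ a) (hc : 0 ≤ c) (hm : 0 < m2) (q : Tor Mv) :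
    effSym N Mv a c m2 q ≤ a := by
  unfold effSym
  have hS := Sfib_nonneg (N := N) (M := Mv) hc hm q
  exact div_le_self ha (by nlinarith)

/-- ★ **`⟨ψ, Δ^{(K)}ψ⟩ ≤ a·|ψ|²`** along King's run (`K ≥ 1`): the symbol (4.5) is `≤ a_K ≤ a`, Plancherel. [cite: King1986, (4.5) p.670, (4.35) p.674] -/
theorem effLaplacian_form_le_a (hL : 2 ≤ L) {a m2 : ℝ} (ha : 0 < a) (hm : 0 < m2) {K : ℕ} (hK : 1 ≤ K) (ψ : Tor M → ℝ) :
    haveI : NeZero L := ⟨by omega⟩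
    ψ ⬝ᵥ (effLaplacian (L ^ K) M (aK a L K) (((L ^ K : ℕ) : ℝ) ^ 2) m2 *ᵥ ψ) ≤ a * (ψ ⬝ᵥ ψ) := by
  haveI : NeZero L := ⟨by omega⟩
  have hL1 : (1 : ℝ) < L := by exact_mod_cast (show 1 < L by omega)
  have haK := aK_pos ha hL1 hK
  have haKle := aK_le ha hL1 hK
  have hform := effLaplacian_form (L ^ K) M (c := ((L ^ K : ℕ) : ℝ) ^ 2) haK.le (by positivity) hm ψ
  have hpars : ∑ q : Tor M, ‖ft M ψ q‖ ^ 2 = (Fintype.card (Tor M) : ℝ) * (ψ ⬝ᵥ ψ) := (parseval_dot M ψ).symm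
  have hcM : (0 : ℝ) < Fintype.card (Tor M) := by exact_mod_cast Fintype.card_pos
  have hsum : ∑ q : Tor M, effSym (L ^ K) M (aK a L K) (((L ^ K : ℕ) : ℝ) ^ 2) m2 q * ‖ft M ψ q‖ ^ 2 ≤ a * ∑ q : Tor M, ‖ft M ψ q‖ ^ 2 := by
    rw [Finset.mul_sum]
    exact Finset.sum_le_sum fun q _ => mul_le_mul_of_nonneg_right
      ((effSym_le_a' (L ^ K) M haK.le (by positivity) hm q).trans haKle) (sq_nonneg _)
  rw [hpars] at hsum
  rw [← hform] at hsum
  nlinarith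

/-- ★ **`𝒩(Δ^{(K)}) ≥ (√(2π∕a))^{|Ω|}`** uniformly in `K ≥ 1` (part Τ-a's sandwich with `δ_∞ ≤ Δ^{(K)} ≤ a`). [cite: King1986, (3.89)–(3.90) pp.668–669] -/
theorem gaussNorm_effLaplacian_ge (hL : 2 ≤ L) {a m2 : ℝ} (ha : 0 < a) (hm : 0 < m2) {K : ℕ} (hK : 1 ≤ K) :
    haveI : NeZero L := ⟨by omega⟩
    Real.sqrt (2 * Real.pi / a) ^ Fintype.card (Tor M) ≤ gaussNorm (effLaplacian (L ^ K) M (aK a L K) (((L ^ K : ℕ) : ℝ) ^ 2) m2) := by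
  haveI : NeZero L := ⟨by omega⟩
  have hL1 : (1 : ℝ) < L := by exact_mod_cast (show 1 < L by omega)
  have hδ : 0 < ((aInf a L)⁻¹ + m2⁻¹)⁻¹ := by have := aInf_pos ha hL1; positivity
  exact (gaussNorm_sandwich hδ (coercive_effLaplacian_unif L M hL ha hm hK) ha (effLaplacian_form_le_a L M hL ha hm hK)).1

/-- ★ **THE UNIFORM GAUSSIAN MAJORANT**: `ρ_K(ψ) ≤ e^{−½⟨ψ,(δ_∞·1)ψ⟩}∕(√(2π∕a))^{|Ω|}` for every `K ≥ 1` and `ψ`. [cite: King1986, (2.6) p.652, (3.89)–(3.90) pp.668–669] -/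
theorem gaussDensity_effLaplacian_le (hL : 2 ≤ L) {a m2 : ℝ} (ha : 0 < a) (hm : 0 < m2) {K : ℕ} (hK : 1 ≤ K) (ψ : Tor M → ℝ) :
    haveI : NeZero L := ⟨by omega⟩
    Real.exp (-(1 / 2 : ℝ) * (ψ ⬝ᵥ (effLaplacian (L ^ K) M (aK a L K) (((L ^ K : ℕ) : ℝ) ^ 2) m2 *ᵥ ψ)))
        / gaussNorm (effLaplacian (L ^ K) M (aK a L K) (((L ^ K : ℕ) : ℝ) ^ 2) m2)
      ≤ Real.exp (-(1 / 2 : ℝ) * (ψ ⬝ᵥ (((((aInf a L)⁻¹ + m2⁻¹)⁻¹) • (1 : Matrix (Tor M) (Tor M) ℝ)) *ᵥ ψ)))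
        / Real.sqrt (2 * Real.pi / a) ^ Fintype.card (Tor M) := by
  haveI : NeZero L := ⟨by omega⟩
  have hlo : 0 < Real.sqrt (2 * Real.pi / a) ^ Fintype.card (Tor M) := by positivity
  have hloN := gaussNorm_effLaplacian_ge L M hL ha hm hK
  have hc := coercive_effLaplacian_unif L M hL ha hm hK ψ
  have hnum : Real.exp (-(1 / 2 : ℝ) * (ψ ⬝ᵥ (effLaplacian (L ^ K) M (aK a L K) (((L ^ K : ℕ) : ℝ) ^ 2) m2 *ᵥ ψ)))
      ≤ Real.exp (-(1 / 2 : ℝ) * (ψ ⬝ᵥ (((((aInf a L)⁻¹ + m2⁻¹)⁻¹) • (1 : Matrix (Tor M) (Tor M) ℝ)) *ᵥ ψ))) := by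
    rw [quad_scalar, show ∑ i, ψ i ^ 2 = ψ ⬝ᵥ ψ by simp [dotProduct, sq]]
    exact Real.exp_le_exp.mpr (by nlinarith)
  calc _ ≤ Real.exp (-(1 / 2 : ℝ) * (ψ ⬝ᵥ (((((aInf a L)⁻¹ + m2⁻¹)⁻¹) • (1 : Matrix (Tor M) (Tor M) ℝ)) *ᵥ ψ)))
          / gaussNorm (effLaplacian (L ^ K) M (aK a L K) (((L ^ K : ℕ) : ℝ) ^ 2) m2) :=
        div_le_div_of_nonneg_right hnum (lt_of_lt_of_le hlo hloN).le
    _ ≤ _ := div_le_div_of_nonneg_left (Real.exp_pos _).le hlo hloN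

/-- The limit density is integrable. [cite: King1986, (2.6) p.652] -/
theorem integrable_gaussDensity_lim (hLodd : Odd L) (hL : 2 ≤ L) {a m2 : ℝ} (ha : 0 < a) (hm : 0 < m2) :
    Integrable (fun ψ : Tor M → ℝ => Real.exp (-(1 / 2 : ℝ) * (ψ ⬝ᵥ ((Matrix.of fun b b' => effLaplacianLim L M a m2 b b') *ᵥ ψ)))
      / gaussNorm (Matrix.of fun b b' => effLaplacianLim L M a m2 b b')) := by
  have hL1 : (1 : ℝ) < L := by exact_mod_cast (show 1 < L by omega)
  exact (integrable_gauss (by have := aInf_pos ha hL1; positivity) (coercive_effLaplacianLim L M hLodd hL ha hm)).div_const _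

/-! ## §2 Total variation convergence -/

/-- ★★★ **THE LAWS OF THE BLOCK FIELDS CONVERGE IN TOTAL VARIATION**: `∫|ρ_K(ψ) − ρ_∞(ψ)| dψ → 0` as `K → ∞` (`L` odd `≥ 2`, `a, m² > 0`, every unit torus) —
Scheffé's conclusion by dominated convergence with the uniform Gaussian majorant. [cite: King1986, Thm 2.1 (2.22) p.654, Thm 3.4 (3.9) p.656, (2.6) p.652] -/
theorem tendsto_integral_abs_gaussDensity_sub (hLodd : Odd L) (hL : 2 ≤ L) {a m2 : ℝ} (ha : 0 < a) (hm : 0 < m2) :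
    haveI : NeZero L := ⟨by omega⟩
    Tendsto (fun K : ℕ => ∫ ψ : Tor M → ℝ,
        |Real.exp (-(1 / 2 : ℝ) * (ψ ⬝ᵥ (effLaplacian (L ^ K) M (aK a L K) (((L ^ K : ℕ) : ℝ) ^ 2) m2 *ᵥ ψ)))
            / gaussNorm (effLaplacian (L ^ K) M (aK a L K) (((L ^ K : ℕ) : ℝ) ^ 2) m2)
          - Real.exp (-(1 / 2 : ℝ) * (ψ ⬝ᵥ ((Matrix.of fun b b' => effLaplacianLim L M a m2 b b') *ᵥ ψ)))
            / gaussNorm (Matrix.of fun b b' => effLaplacianLim L M a m2 b b')|) atTop (𝓝 0) := by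
  haveI : NeZero L := ⟨by omega⟩
  have hL1 : (1 : ℝ) < L := by exact_mod_cast (show 1 < L by omega)
  set δ := ((aInf a L)⁻¹ + m2⁻¹)⁻¹ with hδdef
  have hδ : 0 < δ := by have := aInf_pos ha hL1; positivity
  have hlo : 0 < Real.sqrt (2 * Real.pi / a) ^ Fintype.card (Tor M) := by positivity
  have hcont : ∀ (Δ : Matrix (Tor M) (Tor M) ℝ) (c : ℝ), Continuous fun ψ : Tor M → ℝ => Real.exp (-(1 / 2 : ℝ) * (ψ ⬝ᵥ (Δ *ᵥ ψ))) / c := by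
    intro Δ c
    simp only [dotProduct, Matrix.mulVec]
    fun_prop
  have hrho := integrable_gaussDensity_lim L M hLodd hL ha hm
  have hrhonn : ∀ ψ : Tor M → ℝ, 0 ≤ Real.exp (-(1 / 2 : ℝ) * (ψ ⬝ᵥ ((Matrix.of fun b b' => effLaplacianLim L M a m2 b b') *ᵥ ψ)))
      / gaussNorm (Matrix.of fun b b' => effLaplacianLim L M a m2 b b') := fun ψ =>
    div_nonneg (Real.exp_pos _).le (gaussNorm_pos (by have := aInf_pos ha hL1; positivity) (coercive_effLaplacianLim L M hLodd hL ha hm)).le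
  have h := tendsto_integral_filter_of_dominated_convergence (l := atTop) (μ := (volume : Measure (Tor M → ℝ)))
    (F := fun (K : ℕ) (ψ : Tor M → ℝ) =>
        |Real.exp (-(1 / 2 : ℝ) * (ψ ⬝ᵥ (effLaplacian (L ^ K) M (aK a L K) (((L ^ K : ℕ) : ℝ) ^ 2) m2 *ᵥ ψ)))
            / gaussNorm (effLaplacian (L ^ K) M (aK a L K) (((L ^ K : ℕ) : ℝ) ^ 2) m2)
          - Real.exp (-(1 / 2 : ℝ) * (ψ ⬝ᵥ ((Matrix.of fun b b' => effLaplacianLim L M a m2 b b') *ᵥ ψ)))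
            / gaussNorm (Matrix.of fun b b' => effLaplacianLim L M a m2 b b')|)
    (f := fun _ => (0 : ℝ))
    (fun ψ : Tor M → ℝ => Real.exp (-(1 / 2 : ℝ) * (ψ ⬝ᵥ ((δ • (1 : Matrix (Tor M) (Tor M) ℝ)) *ᵥ ψ))) / Real.sqrt (2 * Real.pi / a) ^ Fintype.card (Tor M)
      + Real.exp (-(1 / 2 : ℝ) * (ψ ⬝ᵥ ((Matrix.of fun b b' => effLaplacianLim L M a m2 b b') *ᵥ ψ)))
        / gaussNorm (Matrix.of fun b b' => effLaplacianLim L M a m2 b b')) ?_ ?_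
    (((integrable_gauss hδ (coercive_scalar δ)).div_const _).add hrho) ?_
  · rwa [integral_zero] at h
  · exact Eventually.of_forall fun K => (((hcont _ _).sub (hcont _ _)).abs).aestronglyMeasurable
  · filter_upwards [eventually_ge_atTop 1] with K hK
    refine Eventually.of_forall fun ψ => ?_
    rw [Real.norm_eq_abs, abs_abs]
    have h1 := gaussDensity_effLaplacian_le L M hL ha hm hK ψ
    have h0 : 0 ≤ Real.exp (-(1 / 2 : ℝ) * (ψ ⬝ᵥ (effLaplacian (L ^ K) M (aK a L K) (((L ^ K : ℕ) : ℝ) ^ 2) m2 *ᵥ ψ)))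
        / gaussNorm (effLaplacian (L ^ K) M (aK a L K) (((L ^ K : ℕ) : ℝ) ^ 2) m2) :=
      div_nonneg (Real.exp_pos _).le (lt_of_lt_of_le hlo (gaussNorm_effLaplacian_ge L M hL ha hm hK)).le
    have h2 := hrhonn ψ
    rw [abs_le]
    constructor <;> linarith
  · refine Eventually.of_forall fun ψ => ?_
    have ht := ((tendsto_gaussDensity_effLaplacian L M hLodd hL ha hm ψ).sub
      (tendsto_const_nhds (x := Real.exp (-(1 / 2 : ℝ) * (ψ ⬝ᵥ ((Matrix.of fun b b' => effLaplacianLim L M a m2 b b') *ᵥ ψ)))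
        / gaussNorm (Matrix.of fun b b' => effLaplacianLim L M a m2 b b')))).abs
    simpa using ht

/-! ## §3 Expectations of bounded observables converge -/

/-- ★★★ **`⟨F⟩_K → ⟨F⟩_∞` FOR EVERY BOUNDED OBSERVABLE**: for `F : ℝ^Ω → ℝ` a.e.-strongly measurable with `|F| ≤ C`, `∫ F ρ_K dψ → ∫ F ρ_∞ dψ` (`L` odd `≥ 2`, `a, m² > 0`)
— `|∫F(ρ_K − ρ_∞)| ≤ C·∫|ρ_K − ρ_∞| → 0`. [cite: King1986, Thm 2.1 (2.22) p.654, Thm 3.4 (3.9) p.656] -/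
theorem tendsto_integral_observable (hLodd : Odd L) (hL : 2 ≤ L) {a m2 : ℝ} (ha : 0 < a) (hm : 0 < m2) {F : (Tor M → ℝ) → ℝ} {C : ℝ}
    (hF : AEStronglyMeasurable F volume) (hFC : ∀ ψ, |F ψ| ≤ C) :
    haveI : NeZero L := ⟨by omega⟩
    Tendsto (fun K : ℕ => ∫ ψ : Tor M → ℝ, F ψ * (Real.exp (-(1 / 2 : ℝ) * (ψ ⬝ᵥ (effLaplacian (L ^ K) M (aK a L K) (((L ^ K : ℕ) : ℝ) ^ 2) m2 *ᵥ ψ)))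
        / gaussNorm (effLaplacian (L ^ K) M (aK a L K) (((L ^ K : ℕ) : ℝ) ^ 2) m2))) atTop
      (𝓝 (∫ ψ : Tor M → ℝ, F ψ * (Real.exp (-(1 / 2 : ℝ) * (ψ ⬝ᵥ ((Matrix.of fun b b' => effLaplacianLim L M a m2 b b') *ᵥ ψ)))
        / gaussNorm (Matrix.of fun b b' => effLaplacianLim L M a m2 b b')))) := by
  haveI : NeZero L := ⟨by omega⟩
  have hL1 : (1 : ℝ) < L := by exact_mod_cast (show 1 < L by omega)
  have hC0 : 0 ≤ C := (abs_nonneg _).trans (hFC 0)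
  have hcont : ∀ (Δ : Matrix (Tor M) (Tor M) ℝ) (c : ℝ), Continuous fun ψ : Tor M → ℝ => Real.exp (-(1 / 2 : ℝ) * (ψ ⬝ᵥ (Δ *ᵥ ψ))) / c := by
    intro Δ c
    simp only [dotProduct, Matrix.mulVec]
    fun_prop
  have hFC' : ∀ᵐ ψ : Tor M → ℝ, ‖F ψ‖ ≤ C := Eventually.of_forall fun ψ => by rw [Real.norm_eq_abs]; exact hFC ψ
  have hrho := integrable_gaussDensity_lim L M hLodd hL ha hm
  -- integrability of the level-K density (K ≥ 1)
  have hrhoK : ∀ K, 1 ≤ K → Integrable (fun ψ : Tor M → ℝ =>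
      Real.exp (-(1 / 2 : ℝ) * (ψ ⬝ᵥ (effLaplacian (L ^ K) M (aK a L K) (((L ^ K : ℕ) : ℝ) ^ 2) m2 *ᵥ ψ)))
        / gaussNorm (effLaplacian (L ^ K) M (aK a L K) (((L ^ K : ℕ) : ℝ) ^ 2) m2)) := fun K hK =>
    (integrable_gauss (by have := aInf_pos ha hL1; positivity : 0 < ((aInf a L)⁻¹ + m2⁻¹)⁻¹)
      (coercive_effLaplacian_unif L M hL ha hm hK)).div_const _
  have hTV := tendsto_integral_abs_gaussDensity_sub L M hLodd hL ha hm
  have hg : Tendsto (fun K : ℕ => C * ∫ ψ : Tor M → ℝ,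
      |Real.exp (-(1 / 2 : ℝ) * (ψ ⬝ᵥ (effLaplacian (L ^ K) M (aK a L K) (((L ^ K : ℕ) : ℝ) ^ 2) m2 *ᵥ ψ)))
            / gaussNorm (effLaplacian (L ^ K) M (aK a L K) (((L ^ K : ℕ) : ℝ) ^ 2) m2)
          - Real.exp (-(1 / 2 : ℝ) * (ψ ⬝ᵥ ((Matrix.of fun b b' => effLaplacianLim L M a m2 b b') *ᵥ ψ)))
            / gaussNorm (Matrix.of fun b b' => effLaplacianLim L M a m2 b b')|) atTop (𝓝 0) := by
    have h := hTV.const_mul C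
    rwa [mul_zero] at h
  rw [tendsto_iff_norm_sub_tendsto_zero]
  refine squeeze_zero' (Eventually.of_forall fun K => norm_nonneg _) ?_ hg
  filter_upwards [eventually_ge_atTop 1] with K hK
  have hIK := (hrhoK K hK).bdd_mul hF hFC'
  have hIlim := hrho.bdd_mul hF hFC'
  rw [← integral_sub hIK hIlim, Real.norm_eq_abs]
  have hdiff : Integrable (fun ψ : Tor M → ℝ =>
      Real.exp (-(1 / 2 : ℝ) * (ψ ⬝ᵥ (effLaplacian (L ^ K) M (aK a L K) (((L ^ K : ℕ) : ℝ) ^ 2) m2 *ᵥ ψ)))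
          / gaussNorm (effLaplacian (L ^ K) M (aK a L K) (((L ^ K : ℕ) : ℝ) ^ 2) m2)
        - Real.exp (-(1 / 2 : ℝ) * (ψ ⬝ᵥ ((Matrix.of fun b b' => effLaplacianLim L M a m2 b b') *ᵥ ψ)))
          / gaussNorm (Matrix.of fun b b' => effLaplacianLim L M a m2 b b')) := (hrhoK K hK).sub hrho
  calc |∫ ψ : Tor M → ℝ, (F ψ * (Real.exp (-(1 / 2 : ℝ) * (ψ ⬝ᵥ (effLaplacian (L ^ K) M (aK a L K) (((L ^ K : ℕ) : ℝ) ^ 2) m2 *ᵥ ψ)))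
            / gaussNorm (effLaplacian (L ^ K) M (aK a L K) (((L ^ K : ℕ) : ℝ) ^ 2) m2))
          - F ψ * (Real.exp (-(1 / 2 : ℝ) * (ψ ⬝ᵥ ((Matrix.of fun b b' => effLaplacianLim L M a m2 b b') *ᵥ ψ)))
            / gaussNorm (Matrix.of fun b b' => effLaplacianLim L M a m2 b b')))|
      ≤ ∫ ψ : Tor M → ℝ, |F ψ * (Real.exp (-(1 / 2 : ℝ) * (ψ ⬝ᵥ (effLaplacian (L ^ K) M (aK a L K) (((L ^ K : ℕ) : ℝ) ^ 2) m2 *ᵥ ψ)))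
            / gaussNorm (effLaplacian (L ^ K) M (aK a L K) (((L ^ K : ℕ) : ℝ) ^ 2) m2))
          - F ψ * (Real.exp (-(1 / 2 : ℝ) * (ψ ⬝ᵥ ((Matrix.of fun b b' => effLaplacianLim L M a m2 b b') *ᵥ ψ)))
            / gaussNorm (Matrix.of fun b b' => effLaplacianLim L M a m2 b b'))| := abs_integral_le_integral_abs
    _ ≤ ∫ ψ : Tor M → ℝ, C * |Real.exp (-(1 / 2 : ℝ) * (ψ ⬝ᵥ (effLaplacian (L ^ K) M (aK a L K) (((L ^ K : ℕ) : ℝ) ^ 2) m2 *ᵥ ψ)))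
            / gaussNorm (effLaplacian (L ^ K) M (aK a L K) (((L ^ K : ℕ) : ℝ) ^ 2) m2)
          - Real.exp (-(1 / 2 : ℝ) * (ψ ⬝ᵥ ((Matrix.of fun b b' => effLaplacianLim L M a m2 b b') *ᵥ ψ)))
            / gaussNorm (Matrix.of fun b b' => effLaplacianLim L M a m2 b b')| := by
        refine integral_mono_of_nonneg (Eventually.of_forall fun ψ => abs_nonneg _) (hdiff.abs.const_mul C)
          (Eventually.of_forall fun ψ => ?_)
        show |_| ≤ C * |_|
        rw [← mul_sub, abs_mul]
        exact mul_le_mul_of_nonneg_right (hFC ψ) (abs_nonneg _)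
    _ = C * ∫ ψ : Tor M → ℝ, |Real.exp (-(1 / 2 : ℝ) * (ψ ⬝ᵥ (effLaplacian (L ^ K) M (aK a L K) (((L ^ K : ℕ) : ℝ) ^ 2) m2 *ᵥ ψ)))
            / gaussNorm (effLaplacian (L ^ K) M (aK a L K) (((L ^ K : ℕ) : ℝ) ^ 2) m2)
          - Real.exp (-(1 / 2 : ℝ) * (ψ ⬝ᵥ ((Matrix.of fun b b' => effLaplacianLim L M a m2 b b') *ᵥ ψ)))
            / gaussNorm (Matrix.of fun b b' => effLaplacianLim L M a m2 b b')| := integral_const_mul _ _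

end TV

end Summit.QuantumFields.YangMills.BalabanUVNodes.N15KingModelRung

end
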